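import Literature.NumberTheory.LFunctions.Zhang2022.RepairGuardedRows
import Literature.NumberTheory.LFunctions.Zhang2022.KnifeEdgeEq148Vacuity
import Literature.NumberTheory.LFunctions.Zhang2022.NumericsSection15AppB
import Literature.NumberTheory.LFunctions.Zhang2022.KnifeEdgeEllThinBDH

/-!
# LS rescue (D-0124 (2)) — E-016 modulo its refuter target P2: the ⟨A⟩-guarded `Eq148DUniform` is «¬(A) eventually»
# in substance, and the priced `Eq148DUniformUncond` is its negation's victim (NEGATIVE LEMMAS MODULO A TYPED HYPOTHESIS)

Y. Zhang, *Discrete mean estimates and the Landau–Siegel zero*, arXiv:2211.02515v1 [Zhang2022LandauSiegel] — an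
unrefereed manuscript under adjudication. **WHAT THIS IS NOT: not a claim about Theorems 1–2 of arXiv:2211.02515, about
Landau–Siegel zeros, about Parity, or about a repaired `Margin232`; NOT a proof or refutation of (14.8), of E-016, of E-016′
or of anything for Zhang's own coefficients `κ* = κ₁∗b`. The one new `Prop` below, `KnifeEdge.Eq148LowerBound A B`, is a
HYPOTHESIS asserted by no one: it types the refuter target «P2» of the card `prime-discharge-thin-bdh` — the DESK claim
(cell note BN-ℓ8 (ii), ls-knife-ell-idea-1 g2, 2026-08-27; independent desk concurrence ls-rescue-ref-1
`rescue/ls-rescue-ref-1/E016-DESK-ref1.md` a77ece0bf51352c2) that for every large `D` and EVERY character there is a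
divisor-bounded coefficient sequence `κ` (random signs over a resonant additive family) whose u017 majorant exceeds
`C·P²·D^{−c}` — whose kernel proof (Poisson for `Δ`, sign averaging, additive large sieve + Gallagher, Hölder) is OPEN
(L–XL). Every theorem here is an implication FROM that hypothesis; refuted-as-typed ≠ refuted-in-print; the summit
(Siegel-zero exclusion) is the target, not the manuscript. The programme SEARCHES and TYPES; no claim about Landau–Siegel
zeros, Theorems 1–2 of arXiv:2211.02515 or a repaired Margin232 until a kernel theorem says so.** (LANDAU–SIEGEL programme
F-S3, cell `landau-siegel`, LS RESCUE seat ls-rescue-ref-1 (refuter, Negative lane); catalogue rows LSR-387 / LSR-615 /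
LSR-712 (E-016 cells), REQSIDE RS-3 (U-b).)

## What is here (kernel bookkeeping only)

* `Eq148LowerBound A B` — P2 as a `Prop`: for every `Bτ ≥ 1`, `c > 0`, `C`, EVENTUALLY in `D` and for every real primitive
  `χ (mod D)` some `κ` with (14.1) (`Eq141 Bτ κ`) has `rhs1417OnAt χ (scalesAt A B D) κ (largeConductorRange …) > C·P²·D^{−c}`.
* `not_eq148DUniformUncond_of_lowerBound` — P2 ⇒ ¬`Eq148DUniformUncond A B` (tested at a large prime modulus with the
  Legendre character, `Numerics.ForAllLarge.at_large_prime`; `a* := 0` satisfies (14.2)).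
* `notAEventually_of_eq148DUniform_of_lowerBound`, `eq148DUniform_iff_notAEventually_of_lowerBound`,
  `theorem1_of_eq148DUniform_of_lowerBound` — MODULO P2 the ⟨A⟩-guarded design-facing hypothesis `Eq148DUniform A B` is
  LITERALLY EQUIVALENT to «¬(A) eventually» and hence gives `Theorem1` by itself, with no design: BN-ℓ8 (ii)'s «hidden
  summit» sentence as a kernel cell (the converse half is the T5 vacuity `KnifeEdgeEll.Vernier.forAllLarge_guarded_of_notA`).
* `not_eq148LowerBound_of_A_le_three`, `not_eq148LowerBound_of_lt_two` — P2 must be read ON THE WINDOW: it is FALSE for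
  `A ≤ 3` and for `A − 2B < 2` (there `Eq148DUniformUncond` holds vacuously, `KnifeEdgeEq148Vacuity`), correcting the
  wording «for every A > 0» of the desk note.
* Part 2 — the same bookkeeping for the FAITHFUL-range ∀κ forms E-016′ (`KnifeEdgeEllThinBDH`: `Eq148DUniformFaithfulUncond`,
  `Eq148DUniformFaithful`, target `C·P²·D^{1/2−c}`) modulo the typed hypothesis `Eq148FaithfulLowerBound A B` (= BN-ℓ8 (i):
  desk-claimed for `B < 1/3` via the resonant adversary's `P²D^{3/2−3B}t₀^{3/2}ℒ^{−2}`, heuristically on all of `(¼,½)`;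
  asserted by no one, kernel-open): `not_eq148DUniformFaithfulUncond_of_lowerBound` (the victim is the ∀κ reading of E-016′ — P2′ produces a `D`-dependent
  bad `κ`; a family-specific `KnifeEdgeEll.PrimeDischarge.FaithfulBoundFor A B κ*` for Zhang's own `κ* = κ₁∗b` is NOT touched),
  `eq148DUniformFaithful_iff_notAEventually_of_lowerBound` (hidden summit), `not_eq148FaithfulLowerBound_of_lt_two` (false off
  the window `A − 2B < 2`), and the one comparison available between the two targets, `faithful_exceeds_of_lowerBound`
  (P2 ⇒ the faithful majorant beats `C·P²·D^{−c}` wherever `P ≤ 2DP₄`, via `rhs1417OnAt_le_rhs148FaithfulAt`).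

References: Zhang, arXiv:2211.02515v1, §14 (14.1)–(14.2) p.76, (14.8) and u017 p.79 (tex L3945–L3963); §2 p.4 (the
standing quantifier), p.6 («¬(A) eventually ⇒ Theorem 1»). Montgomery–Vaughan, *Multiplicative Number Theory I*, ch. 7
(large sieve and its optimality) for the shape of P2. [cite: Zhang2022LandauSiegel, §14 (14.8) p.79]
-/

noncomputable section

open Complex Real

namespace Literature.NumberTheory.LFunctions.Zhang2022.KnifeEdge

open Skeleton EllScales Typed.Sec14

/-- **P2, the refuter target of E-016, as a HYPOTHESIS** (asserted by no one; desk-derived in BN-ℓ8 (ii), kernel-open):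
for every `Bτ ≥ 1`, every `c > 0` and every `C`, eventually in `D` and for every real primitive `χ (mod D)` there is a
coefficient sequence `κ` obeying (14.1) with constant `Bτ` whose u017 majorant on the large-conductor range at the scales
`P = D^A, T = D^B` EXCEEDS `C·P²·D^{−c}`. [cite: Zhang2022LandauSiegel, §14 (14.8) p.79, tex L3945–L3963] -/
def Eq148LowerBound (A B : ℝ) : Prop :=
  ∀ Bτ : ℝ, 1 ≤ Bτ → ∀ c : ℝ, 0 < c → ∀ C : ℝ,
    ForAllLarge fun D _ χ => ∃ κs : ℕ → ℂ, Eq141 Bτ κs ∧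
      C * (scalesAt A B D).P ^ 2 * (D : ℝ) ^ (-c) <
        rhs1417OnAt χ (scalesAt A B D) κs (largeConductorRange (scalesAt A B D) D)

/-- `a* := 0` satisfies (14.2) at any scales for any constant `B ≥ 0`. [cite: Zhang2022LandauSiegel, §14 (14.2) p.76] -/
theorem eq142At_zero (S : Scales) {B : ℝ} (hB : 0 ≤ B) : Eq142At S B 0 :=
  ⟨fun n => by simpa using hB, fun _ _ => rfl⟩

/-- **P2 ⇒ ¬E-016 (priced form).** Modulo `Eq148LowerBound A B`, the unconditional ∀κ statement
`Eq148DUniformUncond A B` is false: test both eventual statements at one large prime modulus with the Legendre character.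
[cite: Zhang2022LandauSiegel, §14 (14.8) p.79] -/
theorem not_eq148DUniformUncond_of_lowerBound {A B : ℝ} (hLB : Eq148LowerBound A B) :
    ¬ Eq148DUniformUncond A B := by
  intro h
  obtain ⟨c, hc, C, hev⟩ := h 1
  obtain ⟨p, -, -, _, χ, hall, κs, hκ, hlt⟩ :=
    Numerics.ForAllLarge.at_large_prime (hev.and (hLB 1 le_rfl c hc C)) 0
  exact absurd (hall κs 0 hκ (eq142At_zero _ zero_le_one)) (not_le.mpr hlt)

/-- **P2 ⇒ the ⟨A⟩-guarded E-016 is «¬(A) eventually» (hidden summit, BN-ℓ8 (ii)).** If eventually every real primitive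
`χ` admits a bad `κ`, then the guarded bound can only hold where the guard `(A)` fails.
[cite: Zhang2022LandauSiegel, §14 (14.8) p.79] -/
theorem notAEventually_of_eq148DUniform_of_lowerBound {A B : ℝ} (hLB : Eq148LowerBound A B)
    (h : Eq148DUniform A B) : ForAllLarge fun D _ χ => ¬ AssumptionA D χ := by
  obtain ⟨c, hc, C, hev⟩ := h 1
  refine (hev.and (hLB 1 le_rfl c hc C)).mono fun D _ χ _ _ hD hA => ?_
  obtain ⟨hall, κs, hκ, hlt⟩ := hD
  exact absurd (hall hA κs 0 hκ (eq142At_zero _ zero_le_one)) (not_le.mpr hlt)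

/-- **Modulo P2, `Eq148DUniform A B ↔ «¬(A) eventually»`** — the design-facing hypothesis carries exactly the conclusion
(`←` is the T5 vacuity `KnifeEdgeEll.Vernier.forAllLarge_guarded_of_notA`, with `c = 1`, `C = 0`).
[cite: Zhang2022LandauSiegel, §14 (14.8) p.79] -/
theorem eq148DUniform_iff_notAEventually_of_lowerBound {A B : ℝ} (hLB : Eq148LowerBound A B) :
    Eq148DUniform A B ↔ ForAllLarge fun D _ χ => ¬ AssumptionA D χ :=
  ⟨notAEventually_of_eq148DUniform_of_lowerBound hLB,
    fun h _ => ⟨1, one_pos, 0, KnifeEdgeEll.Vernier.forAllLarge_guarded_of_notA h⟩⟩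

/-- **Modulo P2 the guarded E-016 proves Theorem 1 with no design at all** (`theorem1_of_notAEventually`): a B-ell
design that lists `Eq148DUniform A B` among its hypotheses assumes, modulo P2, what it sets out to prove.
[cite: Zhang2022LandauSiegel, §2 p. 6] -/
theorem theorem1_of_eq148DUniform_of_lowerBound {A B : ℝ} (hLB : Eq148LowerBound A B) (h : Eq148DUniform A B) :
    Theorem1 :=
  KnifeEdgeEll.Vernier.theorem1_of_notAEventually (notAEventually_of_eq148DUniform_of_lowerBound hLB h)

/-! ## P2 must be read on the window: it is false where (14.8)'s ranges are empty -/

/-- For `A ≤ 3` the print-literal `h`-range is empty, `Eq148DUniformUncond A B` holds vacuously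
(`eq148DUniformUncond_of_A_le_three`), so P2 FAILS there. [cite: Zhang2022LandauSiegel, §14 (14.8) p.79] -/
theorem not_eq148LowerBound_of_A_le_three {A : ℝ} (hA : A ≤ 3) (B : ℝ) : ¬ Eq148LowerBound A B :=
  fun hLB => not_eq148DUniformUncond_of_lowerBound hLB (eq148DUniformUncond_of_A_le_three hA B)

/-- For `A − 2B < 2` the large-conductor range is eventually empty (`eq148DUniformUncond_of_lt_two`), so P2 FAILS there.
[cite: Zhang2022LandauSiegel, §14 (14.8) p.79] -/
theorem not_eq148LowerBound_of_lt_two {A B : ℝ} (hAB : A - 2 * B < 2) : ¬ Eq148LowerBound A B :=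
  fun hLB => not_eq148DUniformUncond_of_lowerBound hLB (eq148DUniformUncond_of_lt_two hAB)

/-! ## Part 2 — the faithful-range ∀κ forms E-016′ modulo their refuter target (BN-ℓ8 (i)) -/

/-- **P2′, the refuter target of the ∀κ form of E-016′, as a HYPOTHESIS** (asserted by no one; desk-derived in BN-ℓ8 (i)
for `B < 1/3`, heuristic on `(¼, ½)`; kernel-open): for every `Bτ ≥ 1`, `c > 0`, `C`, eventually in `D` and for every real
primitive `χ (mod D)` some `κ` obeying (14.1) has FAITHFUL-range u017 majorant `> C·P²·D^{1/2−c}`.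
[cite: Zhang2022LandauSiegel, §14 (14.8) p.79, tex L3945–L3963] -/
def Eq148FaithfulLowerBound (A B : ℝ) : Prop :=
  ∀ Bτ : ℝ, 1 ≤ Bτ → ∀ c : ℝ, 0 < c → ∀ C : ℝ,
    ForAllLarge fun D _ χ => ∃ κs : ℕ → ℂ, Eq141 Bτ κs ∧
      C * (scalesAt A B D).P ^ 2 * (D : ℝ) ^ (1 / 2 - c) <
        rhs148FaithfulAt χ (scalesAt A B D) κs (largeConductorRange (scalesAt A B D) D)

/-- **P2′ ⇒ ¬E-016′ (priced ∀κ form).** [cite: Zhang2022LandauSiegel, §14 (14.8) p.79] -/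
theorem not_eq148DUniformFaithfulUncond_of_lowerBound {A B : ℝ} (hLB : Eq148FaithfulLowerBound A B) :
    ¬ Eq148DUniformFaithfulUncond A B := by
  intro h
  obtain ⟨c, hc, C, hev⟩ := h 1
  obtain ⟨p, -, -, _, χ, hall, κs, hκ, hlt⟩ :=
    Numerics.ForAllLarge.at_large_prime (hev.and (hLB 1 le_rfl c hc C)) 0
  exact absurd (hall κs 0 hκ (eq142At_zero _ zero_le_one)) (not_le.mpr hlt)

/-- **P2′ ⇒ the ⟨A⟩-guarded E-016′ is «¬(A) eventually»** (hidden summit for the faithful form).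
[cite: Zhang2022LandauSiegel, §14 (14.8) p.79] -/
theorem notAEventually_of_eq148DUniformFaithful_of_lowerBound {A B : ℝ} (hLB : Eq148FaithfulLowerBound A B)
    (h : Eq148DUniformFaithful A B) : ForAllLarge fun D _ χ => ¬ AssumptionA D χ := by
  obtain ⟨c, hc, C, hev⟩ := h 1
  refine (hev.and (hLB 1 le_rfl c hc C)).mono fun D _ χ _ _ hD hA => ?_
  obtain ⟨hall, κs, hκ, hlt⟩ := hD
  exact absurd (hall hA κs 0 hκ (eq142At_zero _ zero_le_one)) (not_le.mpr hlt)

/-- **Modulo P2′, `Eq148DUniformFaithful A B ↔ «¬(A) eventually»`.** [cite: Zhang2022LandauSiegel, §14 (14.8) p.79] -/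
theorem eq148DUniformFaithful_iff_notAEventually_of_lowerBound {A B : ℝ} (hLB : Eq148FaithfulLowerBound A B) :
    Eq148DUniformFaithful A B ↔ ForAllLarge fun D _ χ => ¬ AssumptionA D χ :=
  ⟨notAEventually_of_eq148DUniformFaithful_of_lowerBound hLB,
    fun h _ => ⟨1, one_pos, 0, KnifeEdgeEll.Vernier.forAllLarge_guarded_of_notA h⟩⟩

/-- For `A − 2B < 2` the large-conductor range is eventually empty, `Eq148DUniformFaithfulUncond A B` holds vacuously
(`eq148DUniformFaithfulUncond_of_lt_two`), so P2′ FAILS there: it, too, must be read on the window.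
[cite: Zhang2022LandauSiegel, §14 (14.8) p.79] -/
theorem not_eq148FaithfulLowerBound_of_lt_two {A B : ℝ} (hAB : A - 2 * B < 2) : ¬ Eq148FaithfulLowerBound A B :=
  fun hLB => not_eq148DUniformFaithfulUncond_of_lowerBound hLB (eq148DUniformFaithfulUncond_of_lt_two hAB)

/-- **P2′ ⇒ P2 whenever the print-literal cutoff is inside the faithful one and the targets compare** — NOT available:
the targets differ by `D^{1/2}` (`D^{−c}` vs `D^{1/2−c}`) in the direction that makes neither hypothesis imply the other;
recorded instead is the one comparison the tree has (`rhs1417OnAt_le_rhs148FaithfulAt`, truncated ≤ faithful once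
`P ≤ 2DP₄`): P2 ⇒ the faithful majorant also exceeds `C·P²·D^{−c}` eventually, for every `C`, `c > 0`, `Bτ ≥ 1`, PROVIDED
`P ≤ 2DP₄` at those `D`. [cite: Zhang2022LandauSiegel, §14 (14.8) p.79] -/
theorem faithful_exceeds_of_lowerBound {A B : ℝ} (hLB : Eq148LowerBound A B) {Bτ : ℝ} (hBτ : 1 ≤ Bτ) {c : ℝ}
    (hc : 0 < c) (C : ℝ) :
    ForAllLarge fun D _ χ => (scalesAt A B D).P ≤ 2 * (D : ℝ) * (scalesAt A B D).P4 →
      ∃ κs : ℕ → ℂ, Eq141 Bτ κs ∧ C * (scalesAt A B D).P ^ 2 * (D : ℝ) ^ (-c) <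
        rhs148FaithfulAt χ (scalesAt A B D) κs (largeConductorRange (scalesAt A B D) D) := by
  refine (hLB Bτ hBτ c hc C).mono fun D _ χ _ _ hD hP => ?_
  obtain ⟨κs, hκ, hlt⟩ := hD
  exact ⟨κs, hκ, hlt.trans_le (rhs1417OnAt_le_rhs148FaithfulAt χ _ κs _ hP)⟩

end Literature.NumberTheory.LFunctions.Zhang2022.KnifeEdge
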